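import Mathlib
import Literature.Probability.LatticeModels.MessagerMiracleSoleFree
import Literature.Probability.LatticeModels.CriticalTwoPointBounds
import Literature.Probability.LatticeModels.HighDimPointwiseTriviality
import HarnessLib

/-!
# TwoPointSpineGlue (route PrecisionLaplacian, item stmt-CriticalPhenomena-4805) — reflection positivity
# makes the axial profiles log-convex; decrement bounds along the axes

Helper file 8.  Let `G = criticalTwoPoint 3` (`= ⟨σ₀σ_x⟩^f_{β_c}` on `ℤ³`, plus = free at `β_c`).
From the two-point case of the nine-mirror lattice reflection positivity (only the three COORDINATE site
mirrors `xᵢ ↦ -xᵢ` are used) applied to the four-point configurations `{h eᵢ, h eᵢ + z, h' eᵢ, h' eᵢ + z}`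
(`zᵢ = 0`, heights `h, h' ≥ 1`), the sequence `W(n) = 2G(n eᵢ) + 2G(n eᵢ + z)` has a LOG-CONVEX even
subsequence: `W(2h+2)² ≤ W(2h) W(2h+4)` (`logConvex_W`).  Together with the Messager–Miracle-Solé
monotonicity (tree: `twoPointFree_add_single_le`, `twoPointFree_le_single_of_nonneg`) an elementary lemma
on positive non-increasing log-convex sequences (`decrement_le_of_logConvex`:
`U m − U (m+1) ≤ U j / (m − j + 1)`) yields the axial decrement bound of
`…TwoPointSpineGlueAxisDecrement` (the device of Aizenman–Duminil-Copin 2021 §5.5 /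
Duminil-Copin–Panis 2025, in its most elementary form: 2×2 Hankel minors instead of the Stieltjes
moment representation).

Also here: the two-point case `latticeRP_two_of_corr` of the route's nine-mirror RP hypothesis.
No definitions are introduced.
-/

noncomputable section

namespace Summit.CriticalPhenomena.Ising3DConformalLimit.Theorems.SpineGlue

open Finset Real Filter Topology Literature.Probability.LatticeModels

/-! ### Plus = free at `β_c` and the symmetries in use -/

/-- `⟨σ₀σ_x⟩⁺_{β_c} = ⟨σ₀σ_x⟩^f_{β_c}` on `ℤ³` (Aizenman–Duminil-Copin–Sidoravicius 2015). -/
theorem criticalTwoPoint_eq_free (x : Site 3) :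
    criticalTwoPoint 3 x = twoPointFree 3 (criticalBeta 3) x :=
  twoPointPlus_criticalBeta_eq_twoPointFree_holds (d := 3) (by norm_num) x

/-- `G(|x|) = G(x)` (coordinate reflections). -/
theorem criticalTwoPoint_abs (x : Site 3) :
    criticalTwoPoint 3 (fun l => |x l|) = criticalTwoPoint 3 x := by
  rw [criticalTwoPoint_eq_free, criticalTwoPoint_eq_free]
  exact twoPointFree_abs_eq (criticalBeta_nonneg 3) x

/-- Messager–Miracle-Solé along an axis: `G(x + m eᵢ) ≤ G(x)` for `xᵢ ≥ 0`. -/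
theorem criticalTwoPoint_add_single_le (x : Site 3) (i : Fin 3) (hx : 0 ≤ x i) (m : ℕ) :
    criticalTwoPoint 3 (x + Pi.single i (m : ℤ)) ≤ criticalTwoPoint 3 x := by
  rw [criticalTwoPoint_eq_free, criticalTwoPoint_eq_free]
  exact twoPointFree_add_single_le (criticalBeta_nonneg 3) x i hx m

/-- Messager–Miracle-Solé, diagonal form: `G(x + eᵢ − eⱼ) ≤ G(x)` for `xⱼ ≤ xᵢ`. -/
theorem criticalTwoPoint_diag_le (x : Site 3) {i j : Fin 3} (hij : i ≠ j) (hx : x j ≤ x i) :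
    criticalTwoPoint 3 (x + Pi.single i 1 - Pi.single j 1) ≤ criticalTwoPoint 3 x := by
  rw [criticalTwoPoint_eq_free, criticalTwoPoint_eq_free]
  exact messager_miracleSole_diag_free (criticalBeta_nonneg 3) x hij hx

/-- For nonnegative coordinates, `G(z) ≤ G(z_{i₀} e_{i₀})` (zero the other coordinates). -/
theorem criticalTwoPoint_le_single (z : Site 3) (hz : ∀ l, 0 ≤ z l) (i₀ : Fin 3) :
    criticalTwoPoint 3 z ≤ criticalTwoPoint 3 (Pi.single i₀ (z i₀)) := by
  rw [criticalTwoPoint_eq_free, criticalTwoPoint_eq_free]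
  exact twoPointFree_le_single_of_nonneg (criticalBeta_nonneg 3) z hz i₀

/-! ### The two-point case of the nine-mirror lattice reflection positivity -/

/-- Two singleton configurations concatenate to a pair. -/
theorem fin_append_one_one (u v : Site 3) :
    Fin.append (fun _ : Fin 1 => u) (fun _ : Fin 1 => v) = ![u, v] := by
  funext l
  fin_cases l
  · exact Fin.append_left (fun _ : Fin 1 => u) (fun _ : Fin 1 => v) 0
  · exact Fin.append_right (fun _ : Fin 1 => u) (fun _ : Fin 1 => v) 0

/-- The two-point (`k ≡ 1`) case of the route's nine-mirror lattice reflection positivity of the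
critical correlators, written for `G`: `0 ≤ ∑ c_a c_b G(y_b - θ' y_a)` (Fröhlich–Israel–Lieb–Simon 1978,
§3 Thm 3.1). -/
theorem latticeRP_two_of_corr
    (hNine : ∀ (θ : Site 3 → Site 3) (ℓ : Site 3 → ℤ),
      (∃ i j : Fin 3, i ≠ j ∧ ((θ = fun x => Function.update x i (-x i)) ∧ (ℓ = fun x => x i) ∨
        (θ = fun x => x ∘ Equiv.swap i j) ∧ (ℓ = fun x => x i - x j) ∨
        (θ = fun x => Function.update (Function.update x i (-x j)) j (-x i)) ∧ (ℓ = fun x => x i + x j))) →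
      ∀ (m : ℕ) (k : Fin m → ℕ) (x : (a : Fin m) → Fin (k a) → Site 3) (c : Fin m → ℝ),
        (∀ a i, 0 < ℓ (x a i)) →
        0 ≤ ∑ a, ∑ b, c a * c b * criticalCorr 3 (k a + k b) (Fin.append (fun i => θ (x a i)) (x b)))
    (θ' : Site 3 → Site 3) (ℓ : Site 3 → ℤ)
    (hθℓ : ∃ i j : Fin 3, i ≠ j ∧ ((θ' = fun x => Function.update x i (-x i)) ∧ (ℓ = fun x => x i) ∨
      (θ' = fun x => x ∘ Equiv.swap i j) ∧ (ℓ = fun x => x i - x j) ∨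
      (θ' = fun x => Function.update (Function.update x i (-x j)) j (-x i)) ∧ (ℓ = fun x => x i + x j)))
    (m : ℕ) (y : Fin m → Site 3) (c : Fin m → ℝ) (hy : ∀ a, 0 < ℓ (y a)) :
    0 ≤ ∑ a, ∑ b, c a * c b * criticalTwoPoint 3 (y b - θ' (y a)) := by
  have h := hNine θ' ℓ hθℓ m (fun _ => 1) (fun a _ => y a) c (fun a _ => hy a)
  have hconv : ∀ a b, criticalCorr 3 (1 + 1)
      (Fin.append (fun _ : Fin 1 => θ' (y a)) (fun _ : Fin 1 => y b)) =
      criticalTwoPoint 3 (y b - θ' (y a)) := fun a b => by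
    rw [fin_append_one_one, ← criticalCorr_two_pair]
  simpa only [hconv] using h

/-- The coordinate-mirror case: RP of `G` for `θᵢ : x ↦ (…, -xᵢ, …)` on families strictly inside
`{xᵢ > 0}`. -/
theorem latticeRP_coord_of_corr
    (hNine : ∀ (θ : Site 3 → Site 3) (ℓ : Site 3 → ℤ),
      (∃ i j : Fin 3, i ≠ j ∧ ((θ = fun x => Function.update x i (-x i)) ∧ (ℓ = fun x => x i) ∨
        (θ = fun x => x ∘ Equiv.swap i j) ∧ (ℓ = fun x => x i - x j) ∨
        (θ = fun x => Function.update (Function.update x i (-x j)) j (-x i)) ∧ (ℓ = fun x => x i + x j))) →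
      ∀ (m : ℕ) (k : Fin m → ℕ) (x : (a : Fin m) → Fin (k a) → Site 3) (c : Fin m → ℝ),
        (∀ a i, 0 < ℓ (x a i)) →
        0 ≤ ∑ a, ∑ b, c a * c b * criticalCorr 3 (k a + k b) (Fin.append (fun i => θ (x a i)) (x b)))
    (i : Fin 3) (m : ℕ) (y : Fin m → Site 3) (c : Fin m → ℝ) (hy : ∀ a, 0 < y a i) :
    0 ≤ ∑ a, ∑ b, c a * c b * criticalTwoPoint 3 (y b - Function.update (y a) i (-(y a i))) := by
  obtain ⟨j, hj⟩ : ∃ j : Fin 3, j ≠ i := ⟨i + 1, by fin_cases i <;> decide⟩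
  exact latticeRP_two_of_corr hNine (fun x => Function.update x i (-x i)) (fun x => x i)
    ⟨i, j, hj.symm, Or.inl ⟨rfl, rfl⟩⟩ m y c hy

/-! ### Four-point reflection positivity ⇒ log-convexity of `W` -/

section FourPoint

variable {i : Fin 3}

/-- The coordinate mirror on a point `h eᵢ + τ` with `τᵢ = 0`: `θᵢ (h eᵢ + τ) = -h eᵢ + τ`. -/
theorem update_neg_axis_add (h : ℤ) (τ : Site 3) (hτ : τ i = 0) :
    Function.update (h • (Pi.single i 1 : Site 3) + τ) i (-((h • (Pi.single i 1 : Site 3) + τ) i))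
      = (-h) • (Pi.single i 1 : Site 3) + τ := by
  funext l
  by_cases hl : l = i
  · subst hl; simp [hτ]
  · simp [hl]

/-- Differences of a point and a reflected point: `(h' eᵢ + τ') − θᵢ(h eᵢ + τ) = (h + h') eᵢ + (τ' − τ)`. -/
theorem sub_update_neg_axis (h h' : ℤ) (τ τ' : Site 3) (hτ : τ i = 0) :
    (h' • (Pi.single i 1 : Site 3) + τ') -
        Function.update (h • (Pi.single i 1 : Site 3) + τ) i (-((h • (Pi.single i 1 : Site 3) + τ) i))
      = (h + h') • (Pi.single i 1 : Site 3) + (τ' - τ) := by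
  rw [update_neg_axis_add h τ hτ, add_smul, neg_smul]
  abel

/-- Transverse reflection symmetry: `G(n eᵢ − z) = G(n eᵢ + z)` for `zᵢ = 0`. -/
theorem criticalTwoPoint_axis_add_neg (n : ℤ) (z : Site 3) (hz : z i = 0) :
    criticalTwoPoint 3 (n • (Pi.single i 1 : Site 3) + -z) =
      criticalTwoPoint 3 (n • (Pi.single i 1 : Site 3) + z) := by
  rw [← criticalTwoPoint_abs (n • (Pi.single i 1 : Site 3) + -z),
    ← criticalTwoPoint_abs (n • (Pi.single i 1 : Site 3) + z)]
  congr 1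
  funext l
  by_cases hl : l = i
  · subst hl; simp [hz]
  · simp [hl]

/-- **Four-point reflection positivity.** For `zᵢ = 0` and heights `h₁, h₂ ≥ 1`, the quadratic form
`c₁² W(2h₁) + 2c₁c₂ W(h₁+h₂) + c₂² W(2h₂)`, `W(n) = 2G(n eᵢ) + 2G(n eᵢ + z)`, is nonnegative: it is
`⟨θF, F⟩` for `F = c₁(σ_{h₁eᵢ} + σ_{h₁eᵢ+z}) + c₂(σ_{h₂eᵢ} + σ_{h₂eᵢ+z})`. -/
theorem rp_four_point
    (hRP : ∀ (m : ℕ) (y : Fin m → Site 3) (c : Fin m → ℝ), (∀ a, 0 < y a i) →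
      0 ≤ ∑ a, ∑ b, c a * c b * criticalTwoPoint 3 (y b - Function.update (y a) i (-(y a i))))
    (z : Site 3) (hz : z i = 0) {h₁ h₂ : ℤ} (hh₁ : 0 < h₁) (hh₂ : 0 < h₂) (c₁ c₂ : ℝ) :
    0 ≤ c₁ ^ 2 * (2 * criticalTwoPoint 3 ((h₁ + h₁) • (Pi.single i 1 : Site 3)) +
          2 * criticalTwoPoint 3 ((h₁ + h₁) • (Pi.single i 1 : Site 3) + z))
      + 2 * (c₁ * c₂) * (2 * criticalTwoPoint 3 ((h₁ + h₂) • (Pi.single i 1 : Site 3)) +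
          2 * criticalTwoPoint 3 ((h₁ + h₂) • (Pi.single i 1 : Site 3) + z))
      + c₂ ^ 2 * (2 * criticalTwoPoint 3 ((h₂ + h₂) • (Pi.single i 1 : Site 3)) +
          2 * criticalTwoPoint 3 ((h₂ + h₂) • (Pi.single i 1 : Site 3) + z)) := by
  set e : Site 3 := Pi.single i 1 with he
  have h0 : (0 : Site 3) i = 0 := rfl
  have h := hRP 4 ![h₁ • e + 0, h₁ • e + z, h₂ • e + 0, h₂ • e + z] ![c₁, c₁, c₂, c₂] (by
    intro a
    fin_cases a <;> simp [he, hz, hh₁, hh₂])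
  have dz : ∀ (ha hb : ℤ) (τb : Site 3), (hb • e + τb) - Function.update (ha • e + z) i (-((ha • e + z) i))
      = (ha + hb) • e + (τb - z) := fun ha hb τb => sub_update_neg_axis ha hb z τb hz
  have d0 : ∀ (ha hb : ℤ) (τb : Site 3), (hb • e + τb) - Function.update (ha • e + 0) i (-((ha • e + 0) i))
      = (ha + hb) • e + (τb - 0) := fun ha hb τb => sub_update_neg_axis ha hb 0 τb h0
  simp only [Fin.sum_univ_four, Matrix.cons_val_zero, Matrix.cons_val_one, Matrix.cons_val_two,
    Matrix.cons_val_three, Matrix.head_cons, Matrix.tail_cons] at h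
  simp only [dz, d0] at h
  have hneg : ∀ n : ℤ, criticalTwoPoint 3 (n • e + -z) = criticalTwoPoint 3 (n • e + z) := fun n => by
    rw [he]; exact criticalTwoPoint_axis_add_neg n z hz
  simp only [sub_zero, sub_self, zero_sub, add_zero, hneg, add_comm h₂ h₁] at h
  nlinarith [h]

/-- Positivity of a symmetric `2 × 2` quadratic form forces `Q² ≤ P R` (when `P > 0`). -/
theorem sq_le_mul_of_quadratic_nonneg {P Q R : ℝ} (hP : 0 < P)
    (h : ∀ c₁ c₂ : ℝ, 0 ≤ c₁ ^ 2 * P + 2 * (c₁ * c₂) * Q + c₂ ^ 2 * R) : Q ^ 2 ≤ P * R := by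
  have h1 := h (-Q) P
  have h2 : (-Q) ^ 2 * P + 2 * (-Q * P) * Q + P ^ 2 * R = P * (P * R - Q ^ 2) := by ring
  rw [h2] at h1
  nlinarith

/-- **Log-convexity of the even `W`-sequence**: with `U h = 2G(2h eᵢ) + 2G(2h eᵢ + z)` (`zᵢ = 0`),
`U(h+1)² ≤ U(h) U(h+2)` for `h ≥ 1`. -/
theorem logConvex_W
    (hRP : ∀ (m : ℕ) (y : Fin m → Site 3) (c : Fin m → ℝ), (∀ a, 0 < y a i) →
      0 ≤ ∑ a, ∑ b, c a * c b * criticalTwoPoint 3 (y b - Function.update (y a) i (-(y a i))))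
    (hGpos : ∀ x : Site 3, 0 < criticalTwoPoint 3 x)
    (z : Site 3) (hz : z i = 0) {h : ℤ} (hh : 0 < h) :
    (2 * criticalTwoPoint 3 ((2 * (h + 1)) • (Pi.single i 1 : Site 3)) +
        2 * criticalTwoPoint 3 ((2 * (h + 1)) • (Pi.single i 1 : Site 3) + z)) ^ 2 ≤
      (2 * criticalTwoPoint 3 ((2 * h) • (Pi.single i 1 : Site 3)) +
          2 * criticalTwoPoint 3 ((2 * h) • (Pi.single i 1 : Site 3) + z)) *
        (2 * criticalTwoPoint 3 ((2 * (h + 2)) • (Pi.single i 1 : Site 3)) +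
          2 * criticalTwoPoint 3 ((2 * (h + 2)) • (Pi.single i 1 : Site 3) + z)) := by
  have hq := fun c₁ c₂ => rp_four_point hRP z hz hh (show 0 < h + 2 by linarith) c₁ c₂
  rw [show h + h = 2 * h by ring, show h + (h + 2) = 2 * (h + 1) by ring,
    show h + 2 + (h + 2) = 2 * (h + 2) by ring] at hq
  refine sq_le_mul_of_quadratic_nonneg ?_ hq
  have := hGpos ((2 * h) • (Pi.single i 1 : Site 3))
  have := hGpos ((2 * h) • (Pi.single i 1 : Site 3) + z)
  linarith

end FourPoint

/-! ### Positive, non-increasing, log-convex sequences -/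

/-- `ρ^n (1 − ρ) ≤ 1/(n+1)` for `0 ≤ ρ ≤ 1`. -/
theorem pow_mul_one_sub_le {ρ : ℝ} (h0 : 0 ≤ ρ) (h1 : ρ ≤ 1) (n : ℕ) :
    ρ ^ n * (1 - ρ) ≤ 1 / (n + 1) := by
  have hgeom : (∑ k ∈ Finset.range (n + 1), ρ ^ k) * (1 - ρ) = 1 - ρ ^ (n + 1) := geom_sum_mul_neg ρ (n + 1)
  have hterms : ∀ k ∈ Finset.range (n + 1), ρ ^ n ≤ ρ ^ k := fun k hk =>
    pow_le_pow_of_le_one h0 h1 (Nat.lt_succ_iff.1 (Finset.mem_range.1 hk))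
  have hsum : (n + 1 : ℝ) * ρ ^ n ≤ ∑ k ∈ Finset.range (n + 1), ρ ^ k := by
    have := Finset.sum_le_sum hterms
    simpa [Finset.sum_const, Finset.card_range, nsmul_eq_mul] using this
  have h2 : (n + 1 : ℝ) * (ρ ^ n * (1 - ρ)) ≤ 1 := by
    calc (n + 1 : ℝ) * (ρ ^ n * (1 - ρ)) = ((n + 1 : ℝ) * ρ ^ n) * (1 - ρ) := by ring
      _ ≤ (∑ k ∈ Finset.range (n + 1), ρ ^ k) * (1 - ρ) :=
          mul_le_mul_of_nonneg_right hsum (by linarith)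
      _ = 1 - ρ ^ (n + 1) := hgeom
      _ ≤ 1 := by linarith [pow_nonneg h0 (n + 1)]
  rw [le_div_iff₀ (by positivity)]
  linarith

/-- **Decrement bound for a positive, non-increasing, log-convex sequence** (indices `≥ 1`):
`U m − U (m+1) ≤ U j / (m − j + 1)` for `1 ≤ j ≤ m − 1` (the ratios `U(n+1)/U(n)` increase, so
`U m ≤ ρ^{m−j} U j` and `U m − U(m+1) ≤ U m (1 − ρ)` with `ρ = U m / U (m−1)`; then
`ρ^{m−j}(1−ρ) ≤ 1/(m−j+1)`). -/
theorem decrement_le_of_logConvex {U : ℕ → ℝ} (hpos : ∀ n, 1 ≤ n → 0 < U n)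
    (hmono : ∀ n, 1 ≤ n → U (n + 1) ≤ U n)
    (hlc : ∀ n, 1 ≤ n → U (n + 1) ^ 2 ≤ U n * U (n + 2))
    {j m : ℕ} (hj : 1 ≤ j) (hjm : j + 1 ≤ m) :
    U m - U (m + 1) ≤ U j / ((m : ℝ) - j + 1) := by
  -- ratios are nondecreasing
  have hratio : ∀ n, 1 ≤ n → U (n + 1) / U n ≤ U (n + 2) / U (n + 1) := by
    intro n hn
    rw [div_le_div_iff₀ (hpos n hn) (hpos (n + 1) (by omega))]
    nlinarith [hlc n hn]
  have hratio' : ∀ n p, 1 ≤ n → U (n + 1) / U n ≤ U (n + p + 1) / U (n + p) := by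
    intro n p hn
    induction p with
    | zero => simp
    | succ p ih =>
      calc U (n + 1) / U n ≤ U (n + p + 1) / U (n + p) := ih
        _ ≤ U (n + p + 2) / U (n + p + 1) := hratio (n + p) (by omega)
        _ = U (n + (p + 1) + 1) / U (n + (p + 1)) := by ring_nf
  obtain ⟨t, rfl⟩ : ∃ t, m = j + 1 + t := ⟨m - (j + 1), by omega⟩
  set ρ : ℝ := U (j + 1 + t) / U (j + t) with hρ
  have hρ0 : 0 ≤ ρ := div_nonneg (hpos _ (by omega)).le (hpos _ (by omega)).le
  have hρ1 : ρ ≤ 1 := by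
    rw [hρ, div_le_one (hpos _ (by omega))]
    have := hmono (j + t) (by omega)
    simpa [add_assoc, add_comm, add_left_comm] using this
  -- `U (j + n) ≤ ρ^n U j` for `n ≤ t + 1`
  have hgeomb : ∀ n, n ≤ t + 1 → U (j + n) ≤ ρ ^ n * U j := by
    intro n hn
    induction n with
    | zero => simp
    | succ n ih =>
      have ih' := ih (by omega)
      have hr : U (j + n + 1) / U (j + n) ≤ ρ := by
        have := hratio' (j + n) (t - n) (by omega)
        have heq1 : j + n + (t - n) + 1 = j + 1 + t := by omega
        have heq2 : j + n + (t - n) = j + t := by omega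
        rw [heq1, heq2] at this
        exact this
      have hstep : U (j + n + 1) ≤ ρ * U (j + n) := by
        rwa [div_le_iff₀ (hpos (j + n) (by omega))] at hr
      calc U (j + (n + 1)) = U (j + n + 1) := by ring_nf
        _ ≤ ρ * U (j + n) := hstep
        _ ≤ ρ * (ρ ^ n * U j) := mul_le_mul_of_nonneg_left ih' hρ0
        _ = ρ ^ (n + 1) * U j := by ring
  -- the decrement
  have hUm : U (j + 1 + t) ≤ ρ ^ (t + 1) * U j := by
    have := hgeomb (t + 1) le_rfl
    rwa [show j + (t + 1) = j + 1 + t by ring] at this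
  have hrm : ρ ≤ U (j + 1 + t + 1) / U (j + 1 + t) := by
    have := hratio (j + t) (by omega)
    rw [show j + t + 1 = j + 1 + t by ring, show j + t + 2 = j + 1 + t + 1 by ring] at this
    exact this
  have hdec : U (j + 1 + t) - U (j + 1 + t + 1) ≤ U (j + 1 + t) * (1 - ρ) := by
    have hp := hpos (j + 1 + t) (by omega)
    rw [le_div_iff₀ hp] at hrm
    nlinarith
  have hfin : U (j + 1 + t) * (1 - ρ) ≤ U j / ((((j + 1 + t : ℕ) : ℝ)) - j + 1) := by
    have hcast : (((j + 1 + t : ℕ) : ℝ)) - j + 1 = (t + 1 : ℕ) + 1 := by push_cast; ring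
    rw [hcast]
    calc U (j + 1 + t) * (1 - ρ) ≤ ρ ^ (t + 1) * U j * (1 - ρ) :=
          mul_le_mul_of_nonneg_right hUm (by linarith)
      _ = U j * (ρ ^ (t + 1) * (1 - ρ)) := by ring
      _ ≤ U j * (1 / ((t + 1 : ℕ) + 1)) :=
          mul_le_mul_of_nonneg_left (pow_mul_one_sub_le hρ0 hρ1 (t + 1)) (hpos j hj).le
      _ = U j / ((t + 1 : ℕ) + 1) := by ring
  exact hdec.trans hfin

end Summit.CriticalPhenomena.Ising3DConformalLimit.Theorems.SpineGlue

end
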